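import Mathlib
import Summits.ValiantsHypothesis.ValiantsHypothesis.Theses.BarrierLever
import Summits.ValiantsHypothesis.ValiantsHypothesis.Theorems.BarrierLeverPrincipalMinorLayoutsNonsingularRefutation
import Summits.ValiantsHypothesis.ValiantsHypothesis.Theorems.BarrierLeverTransversalSufficesForPrincipal
import Summits.ValiantsHypothesis.ValiantsHypothesis.Theorems.BarrierLeverSplitReductionSufficesForTransversal
import Summits.ValiantsHypothesis.ValiantsHypothesis.Theorems.BarrierLeverTransversalLiteralPairSplit
import Summits.ValiantsHypothesis.ValiantsHypothesis.Theorems.BarrierLeverTransversalTwinFreeReductionHolds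

/-!
# Route BarrierLever — item `TransversalMinorsNonsingularOnIrreducibleLayouts` (stmt-ValiantsHypothesis-19616): REFUTATION

Refutation file (`--workitem stmt-ValiantsHypothesis-19616`; cell valiant-natproofs, rung V4, 𝒟-side;
prover seat val-np-p3 gen 4). Definition-free; a corollary of the refutation of TNS
(`TNSRefutation.not_PrincipalMinorLayoutsNonsingular`, item 19126: at `h = 31` the layout
`u = (∅, {0}, …, {30})`, `w =` all subsets of `{0,…,4}` has a singular principal-minor layout
matrix for EVERY `K`) through arrows already in the tree.

**`not_TransversalMinorsNonsingularOnIrreducibleLayouts`**: TT restricted to R1/twin-irreducible layouts is false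
too, since `TransversalLiteralPairSplit → TransversalTwinFreeReduction → (TT on irreducible layouts) → TT`
(item 19617, `SplitGlue.splitReductionSufficesForTransversal`) with 19587 and 19588 proved, TT ⇒ TNS (19153),
and TNS false. (Consistently, the refuting layout `u = (∅, singletons)`, `w = 2^T` is itself
irreducible in the item's sense: no count coincidence p_a(u) ∈ {{q_c(w), r − q_c(w)}} at `r = 32`,
`p_a ∈ {{0,1}}`, `q_c ∈ {{0,16}}`, and no injective contraction.)

WHAT THIS IS NOT: item 19717 `PartitionMinorsHitByVP` (layout-dependent witnesses) is untouched;
nothing on crux stmt-14610 or `VP` vs `VNP`.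
-/

set_option linter.dupNamespace false

namespace Summit.ValiantsHypothesis.ValiantsHypothesis.Theorems.BarrierLever.TNSRefutation

/-- **TT fails even on irreducible layouts** (item `TransversalMinorsNonsingularOnIrreducibleLayouts`,
stmt-ValiantsHypothesis-19616): by the proved split glue 19617 (with 19587, 19588), TT ⇒ TNS (19153) and
the refutation of TNS. -/
theorem not_TransversalMinorsNonsingularOnIrreducibleLayouts :
    ¬ Summit.ValiantsHypothesis.ValiantsHypothesis.Theses.BarrierLever.TransversalMinorsNonsingularOnIrreducibleLayouts :=
  fun hI => not_PrincipalMinorLayoutsNonsingular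
    (TransversalDictionary.transversalSufficesForPrincipal
      (SplitGlue.splitReductionSufficesForTransversal LiteralSplit.transversalLiteralPairSplit_route
        LiteralLift.transversalTwinFreeReduction_route hI))

end Summit.ValiantsHypothesis.ValiantsHypothesis.Theorems.BarrierLever.TNSRefutation
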